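import Summits.QuantumAdvantage.QuantumAdvantage.Theses.SpinorFlattening
import Literature.Computability.QuantumComplexity.GaussianRank

/-!
# Ideator 3 (gen 2) sketch — crux stmt-QuantumAdvantage-1247 `GaussRankPolyImpliesPPoly`

Typed statements for the ADDENDUM to card `fourier-orbit-deconditioning` (Ideator3Addendum.md):
the one-variable (analytic-arc) reduction of `Decondition`.  Nothing here is a route item.

* `RootsOfUnityExtraction` — exact algebraic core of `stub_cauchy`: averaging a vector polynomial
  of degree `< L` over the `L` scaled roots of unity returns its constant term.
* `CauchyCircleExtraction` — analytic form with the aliasing tail: for `F` holomorphic on the closed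
  disc of radius `R` and bounded by `M` there, the `L`-point average on the circle of radius
  `ρ ≤ R/2` is within `2 M (ρ/R)^L` of `F 0` (sup norm on amplitudes).  With
  `F η = ∑ i, c i η • g i η` (meromorphic coefficients times Gaussian-valued arcs, poles cancelling)
  this re-expresses every vector of a limit span as `r·L` Gaussian terms `g i (ρ ω^l)` with
  coefficients `c i (ρ ω^l) / L`.
* `ArcBoundedThesis` — the shape of the datum the open stub `stub_arc` must deliver for `ψ = |M⟩^{⊗t}`;
  it is literally `Disproof.GaussRankPolyBoundedThesis` with rank `r·L`, recorded here only to make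
  the target of the reduction explicit (`arcBounded_iff` is `Iff.rfl`).
-/

set_option linter.dupNamespace false

noncomputable section

namespace Summit.QuantumAdvantage.QuantumAdvantage.Cruxes.GaussRankPolyImpliesPPoly.Ideator3G2

open Literature.Computability.Cryptography Literature.Computability.QuantumComplexity

/-- `ω_L^l` scaled by `ρ`: the `l`-th of `L` equally spaced points on the circle of radius `ρ`. -/
def circlePoint (ρ : ℂ) (L l : ℕ) : ℂ :=
  ρ * Complex.exp (2 * Real.pi * Complex.I * (l : ℂ) / (L : ℂ))

/-- Exact roots-of-unity extraction (algebraic core of `stub_cauchy`): for a vector polynomial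
`z ↦ ∑_{k ≤ D} z^k • a k` with `D < L` and `ρ ≠ 0`, the average over the `L` points `ρ ω^l`
is the constant term `a 0` (orthogonality `∑_l ω^{l k} = 0` for `0 < k < L`). [folklore] -/
def RootsOfUnityExtraction : Prop :=
  ∀ (n D L : ℕ), D < L → ∀ (a : Fin (D + 1) → (QReg n → ℂ)) (ρ : ℂ), ρ ≠ 0 →
    (L : ℂ)⁻¹ • (∑ l : Fin L, ∑ k : Fin (D + 1), (circlePoint ρ L l) ^ (k : ℕ) • a k) = a 0

/-- Discretised Cauchy formula with aliasing tail (analytic form of `stub_cauchy`): if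
`F : ℂ → (QReg n → ℂ)` is complex-differentiable on the closed disc of radius `R` and bounded by
`M` there, then for `0 < ρ`, `2ρ ≤ R`, `0 < L` the `L`-point circle average at radius `ρ` is within
`2 M (ρ/R)^L` of `F 0` (Cauchy estimates `‖F̂_k‖ ≤ M R^{-k}`, aliasing `∑_{s ≥ 1} F̂_{sL} ρ^{sL}`).
[folklore] -/
def CauchyCircleExtraction : Prop :=
  ∀ (n L : ℕ) (F : ℂ → (QReg n → ℂ)) (M R ρ : ℝ), 0 < L → 0 < ρ → 2 * ρ ≤ R →
    DifferentiableOn ℂ F (Metric.closedBall 0 R) →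
    (∀ z ∈ Metric.closedBall (0 : ℂ) R, ‖F z‖ ≤ M) →
    ‖F 0 - (L : ℂ)⁻¹ • ∑ l : Fin L, F (circlePoint (ρ : ℂ) L l)‖ ≤ 2 * M * (ρ / R) ^ L

/-- The datum `stub_arc` must deliver for `ψ = |M⟩^{⊗t}` after Cauchy extraction: unit Gaussian
terms, coefficients of bit-size `poly(t)`, polynomial count — i.e. bounded-`X`
(`Disproof.GaussRankPolyBoundedThesis`), restated verbatim so the reduction's target is explicit.
NOT asserted (it dies with the kill item 1245 exactly like `X`). [folklore] -/
def ArcBoundedThesis : Prop :=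
  ∀ δ : ℝ, 0 < δ → ∃ c : ℕ, ∀ t : ℕ, ∃ r : ℕ, r ≤ t ^ c + c ∧
    ∃ (a : Fin r → ℂ) (g : Fin r → QReg (t * 4) → ℂ),
      (∀ i, IsGaussian (g i) ∧ normSq (g i) = 1 ∧ ‖a i‖ ≤ 2 ^ (t ^ c + c)) ∧
        normSq (magicMPow t - ∑ i, a i • g i) ≤ δ ^ 2

/-- `ArcBoundedThesis → GaussRankPolyThesis` (forget the bounds; the route's inline `let`s are
definitionally the named API). [folklore] -/
theorem thesis_of_arcBounded (h : ArcBoundedThesis) :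
    Summit.QuantumAdvantage.QuantumAdvantage.Theses.SpinorFlattening.GaussRankPolyThesis := by
  intro δ hδ
  obtain ⟨c, hc⟩ := h δ hδ
  refine ⟨c, fun t => ?_⟩
  obtain ⟨r, hr, a, g, hg, hle⟩ := hc t
  exact ⟨r, hr, a, g, fun i => (hg i).1, hle⟩

end Summit.QuantumAdvantage.QuantumAdvantage.Cruxes.GaussRankPolyImpliesPPoly.Ideator3G2
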